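import Literature.AlgebraicGeometry.Motives.IntegralModelMorphismFibrePoints
import Mathlib.Algebra.BigOperators.Finprod
import HarnessLib

/-!
# Two-section pushforward on points: the generic bridge «two-section special fibre ⇒ pushforward multiset»

`Literature/AlgebraicGeometry/Motives/IntegralModelTwoSectionPushforward.lean`, namespace
`Literature.AlgebraicGeometry.Motives.IntegralModel` (D1 family: ★ `geomReductionMap`, ★ C2a `geomReductionMap_map`,
★ `map_geomReductionMap_of_map_eq`).  Rows (Γ3-A) and (Γ3-A′) of the F0P5a (γ3-GENERIC) desk
(`Gamma3-DESK.v0.1.F0P5a-plan-g2.lean`, statements VERBATIM), currency-neutral and one level above ★ (γ2):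

DATA: proper models `𝒮`, `𝒯` of `X`, `T` at `v`; model morphisms `π₁ π₂ : 𝒯 ⟶ 𝒮` with generic fibres `p₁ p₂ : T ⟶ X`; two
maps `s s'` on `κ̄(v)`-points whose values exhaust every fibre of `π₁ᵥ`; MULTIPLICITY ONE on the `s`-branch when
`s x̄ ≠ s' x̄`.  CONCLUSION: the multiset of reductions of the `p₂`-images of the points over `x` (with weights) is
`{π₂ᵥ (s x̄)} + (n − 1) • {π₂ᵥ (s' x̄)}`, `x̄ = red_𝒮 x`, `n` the total weight.

* `finsum_smul_geomReductionMap_map_eq_of_two_sections` — (Γ3-A′), weights `e` of finite support;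
* `finsum_geomReductionMap_map_eq_of_two_sections` — (Γ3-A), the case `e ≡ 1` on a finite non-empty fibre.

Proof: each `red_𝒯 y` (for `y` over `x`) lies over `x̄` (★ `map_geomReductionMap_of_map_eq`), hence is `s x̄` or `s' x̄`;
`red_𝒮 (p₂ y) = π₂ᵥ (red_𝒯 y)` (★ C2a); the rest is the elementary two-value bookkeeping of §1.  In [Liu2021] (proof of
Cor. D.9, p. 139) the two sections are `T⁺ ≅ 𝒮_w` and `T⁻ → 𝒮_w` purely inseparable of degree `q`, `n = q + 1`; nothing of that
record currency is used here.  THEOREMS only (no definition, no instance, no notation, no named fact, no `sorry`).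
Cell `hodgecm-mathlib`, FLOOR 0, programme F0P5a, crux item stmt-HodgeConjecture-24832 (socket `stub_C3`, line ED. 4 unchanged).
HC_CM is proved only modulo the 7 printed citations until rung 0 closes; this file is generic capital and changes no count.

## References
* [SerreTate1968] J.-P. Serre, J. Tate, *Good reduction of abelian varieties*, Ann. of Math. 88 (1968), §1 (the reduction map).
* [Liu2021] Y. Liu, proof of Cor. D.9, p. 139.
-/

set_option autoImplicit false

noncomputable section

open CategoryTheory AlgebraicGeometry IsDedekindDomain IsDedekindDomain.HeightOneSpectrum
open scoped NumberField
open Literature.NumberTheory.EllipticCurves (genericFibre)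
open Literature.NumberTheory.GaloisRepresentations (closureValuationSubring)
open Literature.NumberTheory.DiophantineGeometry

namespace Literature.AlgebraicGeometry.Motives

namespace IntegralModel

/-! ### §1 Elementary bookkeeping: a weighted sum of singletons taking two values -/

/-- If `z : ι → β` takes only the values `a`, `b`, the weights `e` have finite support and total `n ≥ 1`, and the
`a`-branch carries total weight `1` whenever `a ≠ b`, then `Σ_i e_i • {g (z_i)} = {g a} + (n − 1) • {g b}` as
multisets. [folklore] -/
private theorem finsum_smul_singleton_eq_of_two_values {ι β γ : Type*}
    (z : ι → β) (e : ι → ℕ) (he : (Function.support e).Finite) (a b : β)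
    (hcov : ∀ i, z i = a ∨ z i = b) (n : ℕ) (hn : ∑ᶠ i, e i = n) (hn1 : 1 ≤ n)
    (hone : a ≠ b → ∑ᶠ i : {i // z i = a}, e i.1 = 1) (g : β → γ) :
    ∑ᶠ i, e i • ({g (z i)} : Multiset γ) = {g a} + (n - 1) • ({g b} : Multiset γ) := by
  classical
  set S := he.toFinset with hS
  have hmemS : ∀ i, i ∈ S ↔ e i ≠ 0 := fun i => by rw [hS, Set.Finite.mem_toFinset, Function.mem_support]
  have hsuppS : (Function.support e) ⊆ (S : Set ι) := by rw [hS, Set.Finite.coe_toFinset]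
  have hsupp : Function.support (fun i => e i • ({g (z i)} : Multiset γ)) ⊆ (S : Set ι) :=
    (Function.support_smul_subset_left _ _).trans hsuppS
  rw [finsum_eq_sum_of_support_subset _ hsupp]
  have hn' : ∑ i ∈ S, e i = n := by rw [← hn, finsum_eq_sum_of_support_subset _ hsuppS]
  obtain ⟨k, rfl⟩ : ∃ k, n = k + 1 := ⟨n - 1, by omega⟩
  rw [Nat.add_sub_cancel]
  by_cases hab : a = b
  · subst hab
    have hz : ∀ i, z i = a := fun i => (hcov i).elim id id
    simp_rw [hz]
    rw [← Finset.sum_smul, hn', add_smul, one_smul, add_comm]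
  · rw [← Finset.sum_filter_add_sum_filter_not S (fun i => z i = a)]
    have h1 : ∑ i ∈ S.filter (fun i => z i = a), e i • ({g (z i)} : Multiset γ) =
        (∑ i ∈ S.filter (fun i => z i = a), e i) • ({g a} : Multiset γ) := by
      rw [Finset.sum_smul]
      refine Finset.sum_congr rfl fun i hi => ?_
      rw [(Finset.mem_filter.mp hi).2]
    have h2 : ∑ i ∈ S.filter (fun i => ¬ z i = a), e i • ({g (z i)} : Multiset γ) =
        (∑ i ∈ S.filter (fun i => ¬ z i = a), e i) • ({g b} : Multiset γ) := by
      rw [Finset.sum_smul]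
      refine Finset.sum_congr rfl fun i hi => ?_
      rw [((hcov i).resolve_left (Finset.mem_filter.mp hi).2)]
    have hone' : ∑ i ∈ S.filter (fun i => z i = a), e i = 1 := by
      rw [← hone hab]
      change _ = ∑ᶠ i : ↥({i | z i = a} : Set ι), e i
      rw [finsum_set_coe_eq_finsum_mem]
      refine (finsum_cond_eq_sum_of_cond_iff _ fun {i} hi => ?_).symm
      rw [Finset.mem_filter, hmemS]
      exact ⟨fun h => ⟨hi, h⟩, fun h => h.2⟩
    have hrest : ∑ i ∈ S.filter (fun i => ¬ z i = a), e i = k := by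
      have := Finset.sum_filter_add_sum_filter_not S (fun i => z i = a) e
      rw [hn', hone'] at this
      omega
    rw [h1, h2, hone', hrest, one_smul]

/-- `∑ᶠ` of the constant `1` over a finite type is its cardinality. [folklore] -/
private theorem finsum_one_eq_natCard (α : Type*) [Finite α] : ∑ᶠ _ : α, (1 : ℕ) = Nat.card α := by
  haveI := Fintype.ofFinite α
  rw [finsum_eq_sum_of_fintype, Finset.sum_const, Finset.card_univ, smul_eq_mul, mul_one,
    Nat.card_eq_fintype_card]

/-! ### §2 (Γ3-A′) and (Γ3-A) -/

variable {K : Type} [Field K] [NumberField K] {v : HeightOneSpectrum (𝓞 K)} {X T : SchemeOver K}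

/-- **(Γ3-A′) Two-section pushforward on points, WEIGHTED.**  Proper models `𝒮`, `𝒯` of `X`, `T` at `v`, model morphisms
`π₁ π₂ : 𝒯 ⟶ 𝒮` with generic fibres `p₁ p₂`, a point `x ∈ X(Ω)` with reduction `x̄ = red_𝒮 x`, weights `e` of finite support
and total `n ≥ 1` on the points of `T(Ω)` over `x` (along `p₁`), two maps `s s'` on `κ̄(v)`-points whose values exhaust the
fibres of `π₁ᵥ`, and total weight ONE on the points reducing to `s x̄` whenever `s x̄ ≠ s' x̄`.  Then
`Σ_y e_y • {red_𝒮 (p₂ y)} = {π₂ᵥ (s x̄)} + (n − 1) • {π₂ᵥ (s' x̄)}`.  (At a non-neat level the `α`-indexed Hecke sum is such a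
weighted pull-back 0-cycle; (Γ3-A) is the case `e ≡ 1`.) [cite: SerreTate1968, §1] [cite: Liu2021, proof of Cor. D.9 p. 139 L4–L10] -/
theorem finsum_smul_geomReductionMap_map_eq_of_two_sections
    (𝒮 : IntegralModel (valuationSubringAtPrime K v) K X) (𝒯 : IntegralModel (valuationSubringAtPrime K v) K T)
    [IsProper 𝒮.total.hom] [IsProper 𝒯.total.hom]
    (π₁ π₂ : 𝒯.total ⟶ 𝒮.total) (p₁ p₂ : T ⟶ X)
    (hπ₁ : (genericFibre (valuationSubringAtPrime K v) K).map π₁ ≫ 𝒮.genericIso'.hom = 𝒯.genericIso'.hom ≫ p₁)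
    (hπ₂ : (genericFibre (valuationSubringAtPrime K v) K).map π₂ ≫ 𝒮.genericIso'.hom = 𝒯.genericIso'.hom ≫ p₂)
    (x : AlgPoints X (AlgebraicClosure (v.adicCompletion K)))
    (e : {y : AlgPoints T (AlgebraicClosure (v.adicCompletion K)) // AlgPoints.map p₁ y = x} → ℕ)
    (he : (Function.support e).Finite)
    (n : ℕ) (hn : ∑ᶠ y, e y = n) (hn1 : 1 ≤ n)
    (s s' : AlgPoints 𝒮.reductionAt (geomResidueField v) → AlgPoints 𝒯.reductionAt (geomResidueField v))
    (hcov : ∀ (z : AlgPoints 𝒯.reductionAt (geomResidueField v)) (yb : AlgPoints 𝒮.reductionAt (geomResidueField v)),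
      AlgPoints.map ((specialFibreFunctor v).map π₁) z = yb → z = s yb ∨ z = s' yb)
    (hone : s (𝒮.geomReductionMap x) ≠ s' (𝒮.geomReductionMap x) →
      ∑ᶠ y : {y : {y : AlgPoints T (AlgebraicClosure (v.adicCompletion K)) // AlgPoints.map p₁ y = x} //
          𝒯.geomReductionMap y.1 = s (𝒮.geomReductionMap x)}, e y.1 = 1) :
    ∑ᶠ y, e y • ({𝒮.geomReductionMap (AlgPoints.map p₂ y.1)} : Multiset (AlgPoints 𝒮.reductionAt (geomResidueField v)))
      = {AlgPoints.map ((specialFibreFunctor v).map π₂) (s (𝒮.geomReductionMap x))}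
        + (n - 1) • ({AlgPoints.map ((specialFibreFunctor v).map π₂) (s' (𝒮.geomReductionMap x))} :
            Multiset (AlgPoints 𝒮.reductionAt (geomResidueField v))) := by
  -- C2a along `π₂`: `red_𝒮 (p₂ y) = π₂ᵥ (red_𝒯 y)`
  have hC2a : ∀ y : {y : AlgPoints T (AlgebraicClosure (v.adicCompletion K)) // AlgPoints.map p₁ y = x},
      𝒮.geomReductionMap (AlgPoints.map p₂ y.1) =
        AlgPoints.map ((specialFibreFunctor v).map π₂) (𝒯.geomReductionMap y.1) :=
    fun y => geomReductionMap_map 𝒯 𝒮 π₂ p₂ hπ₂ y.1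
  rw [finsum_congr fun y => congrArg (fun m => e y • ({m} : Multiset _)) (hC2a y)]
  -- every `red_𝒯 y` lies over `x̄`, hence is `s x̄` or `s' x̄`
  have hcov' : ∀ y : {y : AlgPoints T (AlgebraicClosure (v.adicCompletion K)) // AlgPoints.map p₁ y = x},
      𝒯.geomReductionMap y.1 = s (𝒮.geomReductionMap x) ∨ 𝒯.geomReductionMap y.1 = s' (𝒮.geomReductionMap x) :=
    fun y => hcov _ _ (map_geomReductionMap_of_map_eq 𝒮 𝒯 π₁ p₁ hπ₁ x y.1 y.2)
  exact finsum_smul_singleton_eq_of_two_values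
    (z := fun y : {y : AlgPoints T (AlgebraicClosure (v.adicCompletion K)) // AlgPoints.map p₁ y = x} =>
      𝒯.geomReductionMap y.1)
    (e := e) (he := he) (a := s (𝒮.geomReductionMap x)) (b := s' (𝒮.geomReductionMap x)) (hcov := hcov') (n := n)
    (hn := hn) (hn1 := hn1) (hone := hone) (g := AlgPoints.map ((specialFibreFunctor v).map π₂))

/-- **(Γ3-A) Two-section pushforward on points.**  Proper models `𝒮`, `𝒯` of `X`, `T` at `v`, model morphisms `π₁ π₂ : 𝒯 ⟶ 𝒮`
with generic fibres `p₁ p₂`, the `p₁`-fibres of `Ω`-points finite and non-empty, two maps `s s'` on `κ̄(v)`-points whose values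
exhaust the fibres of `π₁ᵥ`, and MULTIPLICITY ONE at `s`: when `s x̄ ≠ s' x̄` exactly one point over `x` reduces to `s x̄`.  Then
for every `x ∈ X(Ω)`: `Σ_{y over x} {red_𝒮 (p₂ y)} = {π₂ᵥ (s x̄)} + (n − 1) • {π₂ᵥ (s' x̄)}`, `n = #p₁⁻¹(x)`, `x̄ = red_𝒮 x`.
[cite: SerreTate1968, §1] [cite: Liu2021, proof of Cor. D.9 p. 139 L4–L10] -/
theorem finsum_geomReductionMap_map_eq_of_two_sections
    (𝒮 : IntegralModel (valuationSubringAtPrime K v) K X) (𝒯 : IntegralModel (valuationSubringAtPrime K v) K T)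
    [IsProper 𝒮.total.hom] [IsProper 𝒯.total.hom]
    (π₁ π₂ : 𝒯.total ⟶ 𝒮.total) (p₁ p₂ : T ⟶ X)
    (hπ₁ : (genericFibre (valuationSubringAtPrime K v) K).map π₁ ≫ 𝒮.genericIso'.hom = 𝒯.genericIso'.hom ≫ p₁)
    (hπ₂ : (genericFibre (valuationSubringAtPrime K v) K).map π₂ ≫ 𝒮.genericIso'.hom = 𝒯.genericIso'.hom ≫ p₂)
    (hfin : ∀ x : AlgPoints X (AlgebraicClosure (v.adicCompletion K)),
      Set.Finite {y : AlgPoints T (AlgebraicClosure (v.adicCompletion K)) | AlgPoints.map p₁ y = x})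
    (hne : ∀ x : AlgPoints X (AlgebraicClosure (v.adicCompletion K)),
      ∃ y : AlgPoints T (AlgebraicClosure (v.adicCompletion K)), AlgPoints.map p₁ y = x)
    (s s' : AlgPoints 𝒮.reductionAt (geomResidueField v) → AlgPoints 𝒯.reductionAt (geomResidueField v))
    (hcov : ∀ (z : AlgPoints 𝒯.reductionAt (geomResidueField v)) (yb : AlgPoints 𝒮.reductionAt (geomResidueField v)),
      AlgPoints.map ((specialFibreFunctor v).map π₁) z = yb → z = s yb ∨ z = s' yb)
    (hone : ∀ x : AlgPoints X (AlgebraicClosure (v.adicCompletion K)),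
      s (𝒮.geomReductionMap x) ≠ s' (𝒮.geomReductionMap x) →
        Set.ncard {y : AlgPoints T (AlgebraicClosure (v.adicCompletion K)) |
          AlgPoints.map p₁ y = x ∧ 𝒯.geomReductionMap y = s (𝒮.geomReductionMap x)} = 1)
    (x : AlgPoints X (AlgebraicClosure (v.adicCompletion K))) :
    ∑ᶠ y : {y : AlgPoints T (AlgebraicClosure (v.adicCompletion K)) // AlgPoints.map p₁ y = x},
        ({𝒮.geomReductionMap (AlgPoints.map p₂ y.1)} : Multiset (AlgPoints 𝒮.reductionAt (geomResidueField v)))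
      = {AlgPoints.map ((specialFibreFunctor v).map π₂) (s (𝒮.geomReductionMap x))}
        + (Nat.card {y : AlgPoints T (AlgebraicClosure (v.adicCompletion K)) // AlgPoints.map p₁ y = x} - 1) •
          ({AlgPoints.map ((specialFibreFunctor v).map π₂) (s' (𝒮.geomReductionMap x))} :
            Multiset (AlgPoints 𝒮.reductionAt (geomResidueField v))) := by
  haveI hF : Finite {y : AlgPoints T (AlgebraicClosure (v.adicCompletion K)) // AlgPoints.map p₁ y = x} :=
    (hfin x).to_subtype
  -- total weight `n = #fibre ≥ 1`
  have hn1 : 1 ≤ Nat.card {y : AlgPoints T (AlgebraicClosure (v.adicCompletion K)) // AlgPoints.map p₁ y = x} := by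
    obtain ⟨y, hy⟩ := hne x
    haveI : Nonempty {y : AlgPoints T (AlgebraicClosure (v.adicCompletion K)) // AlgPoints.map p₁ y = x} :=
      ⟨⟨y, hy⟩⟩
    exact Nat.card_pos
  -- weight one on the `s`-branch
  have hone' : s (𝒮.geomReductionMap x) ≠ s' (𝒮.geomReductionMap x) →
      ∑ᶠ y : {y : {y : AlgPoints T (AlgebraicClosure (v.adicCompletion K)) // AlgPoints.map p₁ y = x} //
          𝒯.geomReductionMap y.1 = s (𝒮.geomReductionMap x)}, (fun _ => (1 : ℕ)) y.1 = 1 := by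
    intro hss'
    haveI : Finite {y : {y : AlgPoints T (AlgebraicClosure (v.adicCompletion K)) // AlgPoints.map p₁ y = x} //
        𝒯.geomReductionMap y.1 = s (𝒮.geomReductionMap x)} := Subtype.finite
    rw [finsum_one_eq_natCard,
      Nat.card_congr (Equiv.subtypeSubtypeEquivSubtypeInter
        (fun y : AlgPoints T (AlgebraicClosure (v.adicCompletion K)) => AlgPoints.map p₁ y = x)
        (fun y => 𝒯.geomReductionMap y = s (𝒮.geomReductionMap x)))]
    change Nat.card ↥({y : AlgPoints T (AlgebraicClosure (v.adicCompletion K)) |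
        AlgPoints.map p₁ y = x ∧ 𝒯.geomReductionMap y = s (𝒮.geomReductionMap x)} : Set _) = 1
    rw [Nat.card_coe_set_eq]
    exact hone x hss'
  have h := finsum_smul_geomReductionMap_map_eq_of_two_sections 𝒮 𝒯 π₁ π₂ p₁ p₂ hπ₁ hπ₂ x (fun _ => 1)
    (Set.toFinite _) _ (finsum_one_eq_natCard _) hn1 s s' hcov hone'
  simp_rw [one_smul] at h
  exact h

end IntegralModel

end Literature.AlgebraicGeometry.Motives

end
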